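import Summits.Ventures.Crystal3D.Theorems.StickyWulffConstantGenericWallFloorStackLedgerTools
import Summits.Ventures.Crystal3D.Theorems.StickyWulffConstantGenericWallFloorTopTerminal
import HarnessLib

/-!
# The stack walk keeps its frames in any mirror-closed family; for NON-CHAIN pairs no walk ends on the far
# sample (the arrivals `ARR` of the stack ledger vanish)

HONEST FRAMING. Part of the venture `Summits/Ventures/Crystal3D` (cell `crystal3d-full`), helper
`--supports` the crux `GenericWallFloor` (stmt-Ventures-19480) of `route-Ventures-StickyWulffConstant`,
registered line `WallLedgerG`, open stub `stub_twoSlabAdhesion` (general fillings).  Sequel of `…StackWalk` /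
`…StackLedger`.  19480-p1's NON-CHAIN hypothesis (a set `𝓕` of frames containing `A₁`, closed under the
`{111}` mirrors `G ↦ (x ↦ G x − 2⟪G x, m⟫ m)`, no member having the linear lattice of `A₂`) controls the
residual `ARR` of `twoSlabAdhesion_stackLedger`:

* `walkStep_frames_mem`, `walkRun_frames_mem` — every frame on the stack of a walk started in `𝓕` stays in
  `𝓕` (a push enters the twin frame `twinFrame F n`, a mirror of the top frame).
* `walkCertified_three_independent` — a certified walker has three linearly independent exact slot
  neighbours in its top frame (the closed vertex star of `−v`).
* `movedFcc_eq_of_exact_neighbours_high` / `_low` — SEALED versions (no clean-sliver hypothesis, via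
  `sealing_above` / `sealing_below`) of 19480-p1's `movedFcc_eq_of_exact_neighbours_top`: a ball off the rim at
  height `≥ h + R₀ + 2` (resp. `≤ −R₀ − 2`) with three independent exact `F`-slot neighbours has
  `F·Λ₀ = A₂·Λ₀` (resp. `= A₁·Λ₀`).
* **`stackWalk_end_not_high`** / **`stackWalk_end_not_low`** — hence, for frames avoiding the far lattice, the
  end ball of a stack walk that stays off the rim is NOT above `h + R₀ + 2` (grain 1) / below `−R₀ − 2`
  (grain 2): the arrivals of the stack ledger are empty for non-chain pairs.

WHAT THIS IS NOT: not the stub; the two-slab inequality without `ARR` is assembled separately; F-C1 not moved.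
-/

noncomputable section

namespace Summit.Ventures.Crystal3D.Theorems

open Summit.Ventures.Crystal3D Finset
open Literature.MathematicalPhysics.StatisticalMechanics (fccStacking)
open scoped InnerProductSpace

variable {X : Finset (EuclideanSpace ℝ (Fin 3))}

/-! ### Frames stay in a mirror-closed family -/

/-- **One step keeps the frames in `𝓕`.** -/
theorem walkStep_frames_mem (z : EuclideanSpace ℝ (Fin 3))
    (𝓕 : Set (EuclideanSpace ℝ (Fin 3) ≃ₗᵢ[ℝ] EuclideanSpace ℝ (Fin 3)))
    (hclosed : ∀ G ∈ 𝓕, ∀ m : EuclideanSpace ℝ (Fin 3), ‖m‖ = 1 →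
      (∀ w ∈ fccSlots, ⟪G w, m⟫_ℝ = 0 ∨ ⟪G w, m⟫_ℝ = Real.sqrt (2 / 3) ∨ ⟪G w, m⟫_ℝ = -Real.sqrt (2 / 3)) →
      ∀ G' : EuclideanSpace ℝ (Fin 3) ≃ₗᵢ[ℝ] EuclideanSpace ℝ (Fin 3),
        (∀ x, G' x = G x - (2 * ⟪G x, m⟫_ℝ) • m) → G' ∈ 𝓕)
    {s s' : EuclideanSpace ℝ (Fin 3) × List WalkEntry} (hs : ∀ e ∈ s.2, e.frame ∈ 𝓕)
    (hstep : walkStep X z s = some s') : ∀ e ∈ s'.2, e.frame ∈ 𝓕 := by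
  classical
  obtain ⟨y, stk⟩ := s
  cases stk with
  | nil => simp at hstep
  | cons e rest =>
    simp only at hs
    by_cases hfull : ∀ w ∈ fccSlots, y + e.frame w ∈ X
    · rw [walkStep_of_full X z y e rest hfull] at hstep
      obtain rfl := Option.some_injective _ hstep
      exact hs
    by_cases hcap : ∃ n, IsOrientedCap X e.frame y e.dir n
    · rw [walkStep_of_cap X z y e rest hfull hcap] at hstep
      obtain rfl := Option.some_injective _ hstep
      obtain ⟨hn, hmenu, -, -, -⟩ := Classical.choose_spec hcap
      set n := Classical.choose hcap with hn_def
      have hnew : (twinFrame e.frame n) ∈ 𝓕 :=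
        hclosed e.frame (hs e (by simp)) n hn hmenu _ fun x => twinFrame_apply e.frame hn x
      have hpush : ∀ rest', (∀ e' ∈ e :: rest', e'.frame ∈ 𝓕) →
          ∀ e' ∈ (pushMove z y e rest' n).2, e'.frame ∈ 𝓕 := by
        intro rest' hrest' e' he'
        simp only [pushMove, List.mem_cons] at he'
        rcases he' with rfl | he'
        · exact hnew
        · exact hrest' e' (by simpa using he')
      cases rest with
      | nil => rw [capMove_nil]; exact hpush [] hs
      | cons e' rest' =>
        by_cases heq : n = e.nrm
        · rw [capMove_cons_of_eq z y e e' rest' heq]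
          intro e'' he''
          exact hs e'' (by simp only [List.mem_cons] at he'' ⊢; exact Or.inr he'')
        · rw [capMove_cons_of_ne z y e e' rest' heq]; exact hpush (e' :: rest') hs
    · rw [walkStep_of_stop X z y e rest hfull hcap] at hstep
      exact absurd hstep (by simp)

/-- **The run keeps the frames in `𝓕`.** -/
theorem walkRun_frames_mem (z : EuclideanSpace ℝ (Fin 3))
    (𝓕 : Set (EuclideanSpace ℝ (Fin 3) ≃ₗᵢ[ℝ] EuclideanSpace ℝ (Fin 3)))
    (hclosed : ∀ G ∈ 𝓕, ∀ m : EuclideanSpace ℝ (Fin 3), ‖m‖ = 1 →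
      (∀ w ∈ fccSlots, ⟪G w, m⟫_ℝ = 0 ∨ ⟪G w, m⟫_ℝ = Real.sqrt (2 / 3) ∨ ⟪G w, m⟫_ℝ = -Real.sqrt (2 / 3)) →
      ∀ G' : EuclideanSpace ℝ (Fin 3) ≃ₗᵢ[ℝ] EuclideanSpace ℝ (Fin 3),
        (∀ x, G' x = G x - (2 * ⟪G x, m⟫_ℝ) • m) → G' ∈ 𝓕) :
    ∀ (k : ℕ) (s : EuclideanSpace ℝ (Fin 3) × List WalkEntry), (∀ e ∈ s.2, e.frame ∈ 𝓕) →
      ∀ e ∈ (walkRun X z k s).2, e.frame ∈ 𝓕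
  | 0, s, hs => by simpa using hs
  | k + 1, s, hs => by
    cases hstep : walkStep X z s with
    | none => rw [walkRun_succ_of_none X z k hstep]; exact hs
    | some s' =>
      rw [walkRun_succ_of_some X z k hstep]
      exact walkRun_frames_mem z 𝓕 hclosed k s' (walkStep_frames_mem z 𝓕 hclosed hs hstep)

/-! ### A certified walker has three independent exact neighbours -/

/-- **Certified ⇒ the closed vertex star of `−v` is occupied ⇒ three independent exact slot neighbours.** -/
theorem walkCertified_three_independent {y : EuclideanSpace ℝ (Fin 3)} {e : WalkEntry}
    (hdir : e.dir ∈ fccSlots) (hC : WalkCertified X y e) :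
    ∃ a ∈ fccSlots, ∃ b ∈ fccSlots, ∃ c ∈ fccSlots, LinearIndependent ℝ ![a, b, c] ∧
      y + e.frame a ∈ X ∧ y + e.frame b ∈ X ∧ y + e.frame c ∈ X := by
  have hstar : ∀ x ∈ fccSlots, ⟪e.frame x, e.frame e.dir⟫_ℝ < 0 → y + e.frame x ∈ X := by
    intro x hx hlt
    rcases hC with ⟨hd, hsh⟩ | ⟨n₀, -, hmenu₀, hpos₀, hd, hocc₀⟩
    · exact exit_owns_closedStar e.frame hdir hd hsh hx hlt
    · have := capper_owns_closedStar e.frame hmenu₀ hd hocc₀ hdir hpos₀ hx hlt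
      rwa [sub_add_cancel] at this
  have hν : e.frame e.dir ≠ 0 := by
    intro h
    have := norm_eq_one_of_mem_fccSlots hdir
    rw [← e.frame.norm_map, h, norm_zero] at this; exact one_ne_zero this.symm
  obtain ⟨a, ha, b, hb, c, hc, h₁, h₂, h₃, hind⟩ := exists_independent_slots_of_hemisphere e.frame hν
  exact ⟨a, ha, b, hb, c, hc, hind, hstar a ha h₁, hstar b hb h₂, hstar c hc h₃⟩

/-! ### Sealed frame identification deep in a clamped sample -/

/-- **High and off the rim, the frame is the top grain's** (sealed: no clean-sliver hypothesis). -/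
theorem movedFcc_eq_of_exact_neighbours_high
    (A₂ : EuclideanSpace ℝ (Fin 3) ≃ₗᵢ[ℝ] EuclideanSpace ℝ (Fin 3)) (t₂ : EuclideanSpace ℝ (Fin 3))
    (X P₂ : Finset (EuclideanSpace ℝ (Fin 3))) (R₀ h ρ : ℝ) (hρ2 : 2 ≤ ρ)
    (hX : ∀ p ∈ X, ∀ q ∈ X, p ≠ q → 1 ≤ dist p q) (hP₂X : P₂ ⊆ X)
    (hcell : ∀ p ∈ X, p 2 ≤ h + 2 * R₀)
    (hP₂ : ∀ p, p ∈ P₂ ↔ (p ∈ (fun q => A₂ q + t₂) '' fccStacking 1 (Real.sqrt (2 / 3)) ∧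
      h + R₀ ≤ p 2 ∧ p 2 ≤ h + 2 * R₀ ∧ p 0 ^ 2 + p 1 ^ 2 ≤ ρ ^ 2))
    (F : EuclideanSpace ℝ (Fin 3) ≃ₗᵢ[ℝ] EuclideanSpace ℝ (Fin 3)) {y : EuclideanSpace ℝ (Fin 3)} (hy : y ∈ X)
    (hy2 : h + R₀ + 2 ≤ y 2) (hyr : y 0 ^ 2 + y 1 ^ 2 ≤ (ρ - 2) ^ 2)
    {a b c : EuclideanSpace ℝ (Fin 3)} (ha : a ∈ fccSlots) (hb : b ∈ fccSlots) (hc : c ∈ fccSlots)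
    (hind : LinearIndependent ℝ ![a, b, c])
    (haX : y + F a ∈ X) (hbX : y + F b ∈ X) (hcX : y + F c ∈ X) :
    F '' fccStacking 1 (Real.sqrt (2 / 3)) = A₂ '' fccStacking 1 (Real.sqrt (2 / 3)) := by
  set Λ₂ : Set (EuclideanSpace ℝ (Fin 3)) := (fun q => A₂ q + t₂) '' fccStacking 1 (Real.sqrt (2 / 3)) with hΛ₂
  have hρ2' : (0 : ℝ) ≤ ρ - 2 := by linarith
  -- slab sealing: high balls off the rim are sample balls, hence on `Λ₂`
  have hseal : ∀ q ∈ X, h + R₀ + 1 ≤ q 2 → q 0 ^ 2 + q 1 ^ 2 ≤ (ρ - 1) ^ 2 → q ∈ Λ₂ := by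
    intro q hq hq2 hqr
    by_cases hqP : q ∈ P₂
    · exact ((hP₂ q).1 hqP).1
    · exact absurd (sealing_above A₂ t₂ (h + R₀) (h + 2 * R₀) ρ (by linarith) X P₂ hX hP₂X hP₂ q hq hqP
        (by linarith) (hcell q hq) hqr) id
  have hyΛ : y ∈ Λ₂ := hseal y hy (by linarith) (hyr.trans (by nlinarith))
  have nbΛ : ∀ {w}, w ∈ fccSlots → y + F w ∈ X → y + F w ∈ Λ₂ := by
    intro w hw hwX
    have hn1 : ‖F w‖ = 1 := by rw [LinearIsometryEquiv.norm_map, norm_eq_one_of_mem_fccSlots hw]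
    apply hseal _ hwX
    · have h1 := abs_apply_sub_le_dist (y + F w) y 2
      rw [dist_eq_norm, add_sub_cancel_left, hn1] at h1
      have := (abs_le.1 h1).1
      linarith
    · have := lateral_sq_add_le y (F w) hρ2' hyr
      rw [hn1] at this
      convert this using 2; ring
  have slotΛ : ∀ {w}, w ∈ fccSlots → y + F w ∈ X → F w ∈ A₂ '' fccStacking 1 (Real.sqrt (2 / 3)) := by
    intro w hw hwX
    have := sub_mem_image_of_mem_affine A₂ t₂ _ _ (nbΛ hw hwX) hyΛ
    rwa [add_sub_cancel_left] at this
  exact movedFcc_eq_of_three_independent_units F A₂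
    ⟨a, mem_fcc_of_mem_fccSlots ha, rfl⟩ ⟨b, mem_fcc_of_mem_fccSlots hb, rfl⟩ ⟨c, mem_fcc_of_mem_fccSlots hc, rfl⟩
    (slotΛ ha haX) (slotΛ hb hbX) (slotΛ hc hcX)
    (by rw [LinearIsometryEquiv.norm_map, norm_eq_one_of_mem_fccSlots ha])
    (by rw [LinearIsometryEquiv.norm_map, norm_eq_one_of_mem_fccSlots hb])
    (by rw [LinearIsometryEquiv.norm_map, norm_eq_one_of_mem_fccSlots hc])
    (linearIndependent_map_triple F hind)

/-- **Low and off the rim, the frame is the bottom grain's** (sealed). -/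
theorem movedFcc_eq_of_exact_neighbours_low
    (A₁ : EuclideanSpace ℝ (Fin 3) ≃ₗᵢ[ℝ] EuclideanSpace ℝ (Fin 3)) (t₁ : EuclideanSpace ℝ (Fin 3))
    (X P₁ : Finset (EuclideanSpace ℝ (Fin 3))) (R₀ ρ : ℝ) (hρ2 : 2 ≤ ρ)
    (hX : ∀ p ∈ X, ∀ q ∈ X, p ≠ q → 1 ≤ dist p q) (hP₁X : P₁ ⊆ X)
    (hcell : ∀ p ∈ X, -(2 * R₀) ≤ p 2)
    (hP₁ : ∀ p, p ∈ P₁ ↔ (p ∈ (fun q => A₁ q + t₁) '' fccStacking 1 (Real.sqrt (2 / 3)) ∧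
      -(2 * R₀) ≤ p 2 ∧ p 2 ≤ -R₀ ∧ p 0 ^ 2 + p 1 ^ 2 ≤ ρ ^ 2))
    (F : EuclideanSpace ℝ (Fin 3) ≃ₗᵢ[ℝ] EuclideanSpace ℝ (Fin 3)) {y : EuclideanSpace ℝ (Fin 3)} (hy : y ∈ X)
    (hy2 : y 2 ≤ -R₀ - 2) (hyr : y 0 ^ 2 + y 1 ^ 2 ≤ (ρ - 2) ^ 2)
    {a b c : EuclideanSpace ℝ (Fin 3)} (ha : a ∈ fccSlots) (hb : b ∈ fccSlots) (hc : c ∈ fccSlots)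
    (hind : LinearIndependent ℝ ![a, b, c])
    (haX : y + F a ∈ X) (hbX : y + F b ∈ X) (hcX : y + F c ∈ X) :
    F '' fccStacking 1 (Real.sqrt (2 / 3)) = A₁ '' fccStacking 1 (Real.sqrt (2 / 3)) := by
  set Λ₁ : Set (EuclideanSpace ℝ (Fin 3)) := (fun q => A₁ q + t₁) '' fccStacking 1 (Real.sqrt (2 / 3)) with hΛ₁
  have hρ2' : (0 : ℝ) ≤ ρ - 2 := by linarith
  have hseal : ∀ q ∈ X, q 2 ≤ -R₀ - 1 → q 0 ^ 2 + q 1 ^ 2 ≤ (ρ - 1) ^ 2 → q ∈ Λ₁ := by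
    intro q hq hq2 hqr
    by_cases hqP : q ∈ P₁
    · exact ((hP₁ q).1 hqP).1
    · exact absurd (sealing_below A₁ t₁ (-(2 * R₀)) (-R₀) ρ (by linarith) X P₁ hX hP₁X hP₁ q hq hqP
        (hcell q hq) (by linarith) hqr) id
  have hyΛ : y ∈ Λ₁ := hseal y hy (by linarith) (hyr.trans (by nlinarith))
  have nbΛ : ∀ {w}, w ∈ fccSlots → y + F w ∈ X → y + F w ∈ Λ₁ := by
    intro w hw hwX
    have hn1 : ‖F w‖ = 1 := by rw [LinearIsometryEquiv.norm_map, norm_eq_one_of_mem_fccSlots hw]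
    apply hseal _ hwX
    · have h1 := abs_apply_sub_le_dist (y + F w) y 2
      rw [dist_eq_norm, add_sub_cancel_left, hn1] at h1
      have := (abs_le.1 h1).2
      linarith
    · have := lateral_sq_add_le y (F w) hρ2' hyr
      rw [hn1] at this
      convert this using 2; ring
  have slotΛ : ∀ {w}, w ∈ fccSlots → y + F w ∈ X → F w ∈ A₁ '' fccStacking 1 (Real.sqrt (2 / 3)) := by
    intro w hw hwX
    have := sub_mem_image_of_mem_affine A₁ t₁ _ _ (nbΛ hw hwX) hyΛ
    rwa [add_sub_cancel_left] at this
  exact movedFcc_eq_of_three_independent_units F A₁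
    ⟨a, mem_fcc_of_mem_fccSlots ha, rfl⟩ ⟨b, mem_fcc_of_mem_fccSlots hb, rfl⟩ ⟨c, mem_fcc_of_mem_fccSlots hc, rfl⟩
    (slotΛ ha haX) (slotΛ hb hbX) (slotΛ hc hcX)
    (by rw [LinearIsometryEquiv.norm_map, norm_eq_one_of_mem_fccSlots ha])
    (by rw [LinearIsometryEquiv.norm_map, norm_eq_one_of_mem_fccSlots hb])
    (by rw [LinearIsometryEquiv.norm_map, norm_eq_one_of_mem_fccSlots hc])
    (linearIndependent_map_triple F hind)

/-! ### No arrivals for frames avoiding the far lattice -/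

/-- **The end of a stack walk with frames avoiding `A₂·Λ₀` is not high.**  If every frame on the start
stack lies in a mirror-closed family `𝓕` avoiding the linear lattice of `A₂`, the start satisfies `WalkInv`,
the fuel suffices, and the end ball is off the rim (lateral radius `≤ ρ − 2`), then the end ball lies
strictly below height `h + R₀ + 2`. -/
theorem stackWalk_end_not_high (hX : ∀ p ∈ X, ∀ q ∈ X, p ≠ q → 1 ≤ dist p q)
    {s₀ : EuclideanSpace ℝ (Fin 3)} (hs₀ : s₀ ∈ fccSlots)
    (hcert : ExactOnly 0 (fccSlots.filter fun w => 0 < ⟪w, s₀⟫_ℝ))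
    (A₂ : EuclideanSpace ℝ (Fin 3) ≃ₗᵢ[ℝ] EuclideanSpace ℝ (Fin 3)) (t₂ : EuclideanSpace ℝ (Fin 3))
    (P₂ : Finset (EuclideanSpace ℝ (Fin 3))) (R₀ h ρ : ℝ) (hρ2 : 2 ≤ ρ) (hP₂X : P₂ ⊆ X)
    (hcell : ∀ p ∈ X, p 2 ≤ h + 2 * R₀)
    (hP₂ : ∀ p, p ∈ P₂ ↔ (p ∈ (fun q => A₂ q + t₂) '' fccStacking 1 (Real.sqrt (2 / 3)) ∧
      h + R₀ ≤ p 2 ∧ p 2 ≤ h + 2 * R₀ ∧ p 0 ^ 2 + p 1 ^ 2 ≤ ρ ^ 2))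
    (𝓕 : Set (EuclideanSpace ℝ (Fin 3) ≃ₗᵢ[ℝ] EuclideanSpace ℝ (Fin 3)))
    (havoid : ∀ G ∈ 𝓕, G '' fccStacking 1 (Real.sqrt (2 / 3)) ≠ A₂ '' fccStacking 1 (Real.sqrt (2 / 3)))
    (hclosed : ∀ G ∈ 𝓕, ∀ m : EuclideanSpace ℝ (Fin 3), ‖m‖ = 1 →
      (∀ w ∈ fccSlots, ⟪G w, m⟫_ℝ = 0 ∨ ⟪G w, m⟫_ℝ = Real.sqrt (2 / 3) ∨ ⟪G w, m⟫_ℝ = -Real.sqrt (2 / 3)) →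
      ∀ G' : EuclideanSpace ℝ (Fin 3) ≃ₗᵢ[ℝ] EuclideanSpace ℝ (Fin 3),
        (∀ x, G' x = G x - (2 * ⟪G x, m⟫_ℝ) • m) → G' ∈ 𝓕)
    {z : EuclideanSpace ℝ (Fin 3)} (hz : ‖z‖ = 1) {H : ℝ} (hH : ∀ p ∈ X, ⟪p, z⟫_ℝ ≤ H)
    {s : EuclideanSpace ℝ (Fin 3) × List WalkEntry} (hInv : WalkInv X z s) (hs𝓕 : ∀ e ∈ s.2, e.frame ∈ 𝓕)
    {N : ℕ} (hN : 8 * (H - ⟪s.1, z⟫_ℝ) < 3 * N)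
    (hyr : (walkRun X z N s).1 0 ^ 2 + (walkRun X z N s).1 1 ^ 2 ≤ (ρ - 2) ^ 2) :
    (walkRun X z N s).1 2 < h + R₀ + 2 := by
  by_contra hge
  push Not at hge
  obtain ⟨hyX, -, -, -, hI, -⟩ := stackWalk_end hX hs₀ hcert hz hH hInv hN
  obtain ⟨-, hS, e, rest, hstk, hC⟩ := hI
  have hframes := walkRun_frames_mem (X := X) z 𝓕 hclosed N s hs𝓕
  have he𝓕 : e.frame ∈ 𝓕 := hframes e (by rw [hstk]; simp)
  rw [hstk] at hS
  obtain ⟨a, ha, b, hb, c, hc, hind, haX, hbX, hcX⟩ := walkCertified_three_independent hS.top.1 hC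
  exact havoid e.frame he𝓕 (movedFcc_eq_of_exact_neighbours_high A₂ t₂ X P₂ R₀ h ρ hρ2 hX hP₂X hcell hP₂
    e.frame hyX hge hyr ha hb hc hind haX hbX hcX)

/-- **The end of a stack walk with frames avoiding `A₁·Λ₀` is not low** (the mirror statement for the
walkers of the top grain). -/
theorem stackWalk_end_not_low (hX : ∀ p ∈ X, ∀ q ∈ X, p ≠ q → 1 ≤ dist p q)
    {s₀ : EuclideanSpace ℝ (Fin 3)} (hs₀ : s₀ ∈ fccSlots)
    (hcert : ExactOnly 0 (fccSlots.filter fun w => 0 < ⟪w, s₀⟫_ℝ))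
    (A₁ : EuclideanSpace ℝ (Fin 3) ≃ₗᵢ[ℝ] EuclideanSpace ℝ (Fin 3)) (t₁ : EuclideanSpace ℝ (Fin 3))
    (P₁ : Finset (EuclideanSpace ℝ (Fin 3))) (R₀ ρ : ℝ) (hρ2 : 2 ≤ ρ) (hP₁X : P₁ ⊆ X)
    (hcell : ∀ p ∈ X, -(2 * R₀) ≤ p 2)
    (hP₁ : ∀ p, p ∈ P₁ ↔ (p ∈ (fun q => A₁ q + t₁) '' fccStacking 1 (Real.sqrt (2 / 3)) ∧
      -(2 * R₀) ≤ p 2 ∧ p 2 ≤ -R₀ ∧ p 0 ^ 2 + p 1 ^ 2 ≤ ρ ^ 2))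
    (𝓕 : Set (EuclideanSpace ℝ (Fin 3) ≃ₗᵢ[ℝ] EuclideanSpace ℝ (Fin 3)))
    (havoid : ∀ G ∈ 𝓕, G '' fccStacking 1 (Real.sqrt (2 / 3)) ≠ A₁ '' fccStacking 1 (Real.sqrt (2 / 3)))
    (hclosed : ∀ G ∈ 𝓕, ∀ m : EuclideanSpace ℝ (Fin 3), ‖m‖ = 1 →
      (∀ w ∈ fccSlots, ⟪G w, m⟫_ℝ = 0 ∨ ⟪G w, m⟫_ℝ = Real.sqrt (2 / 3) ∨ ⟪G w, m⟫_ℝ = -Real.sqrt (2 / 3)) →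
      ∀ G' : EuclideanSpace ℝ (Fin 3) ≃ₗᵢ[ℝ] EuclideanSpace ℝ (Fin 3),
        (∀ x, G' x = G x - (2 * ⟪G x, m⟫_ℝ) • m) → G' ∈ 𝓕)
    {z : EuclideanSpace ℝ (Fin 3)} (hz : ‖z‖ = 1) {H : ℝ} (hH : ∀ p ∈ X, ⟪p, z⟫_ℝ ≤ H)
    {s : EuclideanSpace ℝ (Fin 3) × List WalkEntry} (hInv : WalkInv X z s) (hs𝓕 : ∀ e ∈ s.2, e.frame ∈ 𝓕)
    {N : ℕ} (hN : 8 * (H - ⟪s.1, z⟫_ℝ) < 3 * N)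
    (hyr : (walkRun X z N s).1 0 ^ 2 + (walkRun X z N s).1 1 ^ 2 ≤ (ρ - 2) ^ 2) :
    -R₀ - 2 < (walkRun X z N s).1 2 := by
  by_contra hle
  push Not at hle
  obtain ⟨hyX, -, -, -, hI, -⟩ := stackWalk_end hX hs₀ hcert hz hH hInv hN
  obtain ⟨-, hS, e, rest, hstk, hC⟩ := hI
  have hframes := walkRun_frames_mem (X := X) z 𝓕 hclosed N s hs𝓕
  have he𝓕 : e.frame ∈ 𝓕 := hframes e (by rw [hstk]; simp)
  rw [hstk] at hS
  obtain ⟨a, ha, b, hb, c, hc, hind, haX, hbX, hcX⟩ := walkCertified_three_independent hS.top.1 hC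
  exact havoid e.frame he𝓕 (movedFcc_eq_of_exact_neighbours_low A₁ t₁ X P₁ R₀ ρ hρ2 hX hP₁X hcell hP₁
    e.frame hyX hle hyr ha hb hc hind haX hbX hcX)

end Summit.Ventures.Crystal3D.Theorems

end
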